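import Mathlib
import HarnessLib
import Summits.KontsevichZagierPeriods.Zeta5Search.SorokinLemma3First
import Summits.KontsevichZagierPeriods.Zeta5Search.VWPInnerSwap

/-!
# ζ(5) search — the analytic core of the corrected induction step for Zudilin's theorem (cell `pub-zeta5`, ct-1 g28)

HONEST FRAMING: systematic search; no irrationality claim unless kernel-certified.  An identity of special functions (a multiple
Euler-type integral as a series, GIVEN the inductive hypothesis in abstract form); nothing here is an irrationality result, a
worthiness exponent or a denominator statement; no named fact is discharged; no definition is introduced.

Brick B6c (third part) of `HOME/ct-1/g28/VWP-BLUEPRINT-g28.md` §3 (a)–(f), with the inductive hypothesis ABSTRACTED: if the inner integrals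
`J_k(−s; a_1..a_k | b_1..b_k)` (`s = −t₀+iy`) are known to equal `Γ(b_0+s)/Γ(−s) · R · Σ_μ D_μ Γ(μ−s)/Γ(c+μ+s)` for a constant `R`,
coefficients `D_μ` with `Σ‖D_μ‖(c−t₀+μ)^{−(c−2t₀)θ} < ∞` and a real `c` (in the application: the inductive hypothesis `S(k)` at
`h' = (h₀; −s, h₃, …)`, `R·D_μ` = the `F_{k+2}(h')` term without its `j = 1` factor, `c = 1+h₀`), then

  **`step_core`**: `J_{k+1}(a₀; a_0..a_k | b_0..b_k) = Γ(b_0−a_0)/Γ(a₀) · R · Σ_μ D_μ (−1)^μ Γ(a₀+μ)Γ(a_0+μ)Γ(c−a₀−a_0)/(Γ(c−a_0+μ)Γ(c−a₀+μ))`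

— `SorokinLemma3First.lemma3_first` (peel the first variable), the CANCELLATION of `Γ(−s)` and `Γ(b_0+s)` between the Barnes kernel and
the inductive prefactor, and `VWPInnerSwap.integral_tsum_inner_eq` (term-by-term Lemma 2 at `z = 1`).  What remains for `S(k+1)` is pure
algebra (identify `R`, `D_μ` and resum the very-well-poised series: brick B6c-4) plus the removal of the side conditions (J), (C) by
continuation in `h₀` (B6d–e).

Theorems only; imports `Zeta5Search/SorokinLemma3First`, `Zeta5Search/VWPInnerSwap`.
-/

noncomputable section

namespace Summit.KontsevichZagierPeriods.Zeta5Search.VWPStepCore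

open MeasureTheory Set Filter
open scoped Real
open Literature.NumberTheory.Irrationality.Zudilin2002 (nestedQ sorokinIntegrand)
open Summit.KontsevichZagierPeriods.Zeta5Search.SorokinLemma3First (lemma3_first)
open Summit.KontsevichZagierPeriods.Zeta5Search.VWPInnerSwap (integral_tsum_inner_eq)

variable {t₀ : ℝ} {a₀ : ℂ} {a b : ℕ → ℂ}

/-- **The analytic core of the induction step** (first-variable route): for `k ≥ 1`, complex `a₀, a_j, b_j`, a real `c` and `t₀` with
`0 < t₀ < Re a₀`, `t₀ < Re a_0`, the cut condition `Re a₀ + Re a_0 < Re b_0`, `Re a₀ + Re a_0 < c`, `2t₀ ≤ c`, `1 ≤ c − t₀`, `ε = ±1`,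
`θ ≥ 0` with `Re a₀ + Re a_0 − 2t₀ < (c−2t₀)(1−θ)`; integrability of the `J_{k+1}`-integrand and of the typed `J_k`-integrand at
`(t₀; Re a_{j+1} | Re b_{j+1})`; coefficients `D` with `Σ‖D_μ‖(c−t₀+μ)^{−(c−2t₀)θ} < ∞`; and the ABSTRACT INDUCTIVE HYPOTHESIS
`∀ y, J_k(−s; a_{·+1} | b_{·+1}) = Γ(b_0+s)/Γ(−s) · R · Σ' μ, D μ · Γ(μ−s)/Γ(c+μ+s)` (`s = −t₀+iy`):
`J_{k+1}(a₀; a | b) = Γ(b_0−a_0)/Γ(a₀) · R · Σ' μ, D μ · ((−1)^μ Γ(a₀+μ)Γ(a_0+μ)Γ(c−a₀−a_0)/(Γ(c−a_0+μ)Γ(c−a₀+μ)))`. -/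
theorem step_core {k : ℕ} (hk : 1 ≤ k) (ht₀ : 0 < t₀) (ht₀' : t₀ < a₀.re) (hta : t₀ < (a 0).re)
    (hb : a₀.re + (a 0).re < (b 0).re) {c : ℝ} (hcab : a₀.re + (a 0).re < c) (hc : 2 * t₀ ≤ c) (hc1 : 1 ≤ c - t₀)
    {ε : ℝ} (hε : ε = 1 ∨ ε = -1) {θ : ℝ} (hθ0 : 0 ≤ θ) (hq : a₀.re + (a 0).re - 2 * t₀ < (c - 2 * t₀) * (1 - θ))
    (hF : IntegrableOn (fun x : Fin (k + 1) → ℝ =>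
      (∏ j : Fin (k + 1), ((x j : ℝ) : ℂ) ^ (a j - 1) * (1 - ((x j : ℝ) : ℂ)) ^ (b j - a j - 1)) *
        ((nestedQ (List.ofFn x) : ℝ) : ℂ) ^ (-a₀)) (Set.pi univ fun _ : Fin (k + 1) => Icc (0 : ℝ) 1) volume)
    (hJ : IntegrableOn (sorokinIntegrand k t₀ (fun n => (a (n + 1)).re) (fun n => (b (n + 1)).re))
      (Set.pi univ fun _ : Fin k => Icc (0 : ℝ) 1) volume)
    (R : ℂ) (D : ℕ → ℂ) (hD : Summable fun μ : ℕ => ‖D μ‖ * (c - t₀ + μ) ^ (-((c - 2 * t₀) * θ)))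
    (IH : ∀ y : ℝ,
      ∫ x' in Set.pi univ (fun _ : Fin k => Icc (0 : ℝ) 1),
          (∏ j : Fin k, ((x' j : ℝ) : ℂ) ^ (a (j + 1) - 1) * (1 - ((x' j : ℝ) : ℂ)) ^ (b (j + 1) - a (j + 1) - 1)) *
            ((nestedQ (List.ofFn x') : ℝ) : ℂ) ^ (-(-(-(t₀ : ℂ) + (y : ℂ) * Complex.I))) =
        Complex.Gamma (b 0 + (-(t₀ : ℂ) + (y : ℂ) * Complex.I)) / Complex.Gamma (-(-(t₀ : ℂ) + (y : ℂ) * Complex.I)) * R *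
          ∑' μ : ℕ, D μ * (Complex.Gamma ((μ : ℂ) - (-(t₀ : ℂ) + (y : ℂ) * Complex.I)) /
            Complex.Gamma ((c : ℂ) + μ + (-(t₀ : ℂ) + (y : ℂ) * Complex.I)))) :
    ∫ x in Set.pi univ (fun _ : Fin (k + 1) => Icc (0 : ℝ) 1),
        (∏ j : Fin (k + 1), ((x j : ℝ) : ℂ) ^ (a j - 1) * (1 - ((x j : ℝ) : ℂ)) ^ (b j - a j - 1)) *
          ((nestedQ (List.ofFn x) : ℝ) : ℂ) ^ (-a₀) =
      Complex.Gamma (b 0 - a 0) / Complex.Gamma a₀ * R *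
        ∑' μ : ℕ, D μ * ((-1 : ℂ) ^ μ * (Complex.Gamma (a₀ + μ) * Complex.Gamma (a 0 + μ) * Complex.Gamma (c - a₀ - a 0) /
          (Complex.Gamma (c - a 0 + μ) * Complex.Gamma (c - a₀ + μ)))) := by
  rw [lemma3_first hk ht₀ ht₀' hta hb hε hF hJ]
  -- the cancellation of `Γ(−s)` and `Γ(b_0 + s)` on every fibre
  have hpt : ∀ y : ℝ,
      Complex.Gamma (a₀ + (-(t₀ : ℂ) + (y : ℂ) * Complex.I)) * Complex.Gamma (a 0 + (-(t₀ : ℂ) + (y : ℂ) * Complex.I)) *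
              Complex.Gamma (-(-(t₀ : ℂ) + (y : ℂ) * Complex.I)) /
              Complex.Gamma (b 0 + (-(t₀ : ℂ) + (y : ℂ) * Complex.I)) *
            Complex.exp (ε * π * Complex.I * (-(t₀ : ℂ) + (y : ℂ) * Complex.I)) *
          ∫ x' in Set.pi univ (fun _ : Fin k => Icc (0 : ℝ) 1),
            (∏ j : Fin k, ((x' j : ℝ) : ℂ) ^ (a (j + 1) - 1) * (1 - ((x' j : ℝ) : ℂ)) ^ (b (j + 1) - a (j + 1) - 1)) *
              ((nestedQ (List.ofFn x') : ℝ) : ℂ) ^ (-(-(-(t₀ : ℂ) + (y : ℂ) * Complex.I))) =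
        R * (Complex.Gamma (a₀ + (-(t₀ : ℂ) + (y : ℂ) * Complex.I)) * Complex.Gamma (a 0 + (-(t₀ : ℂ) + (y : ℂ) * Complex.I)) *
            Complex.exp (ε * π * Complex.I * (-(t₀ : ℂ) + (y : ℂ) * Complex.I)) *
          ∑' μ : ℕ, D μ * (Complex.Gamma ((μ : ℂ) - (-(t₀ : ℂ) + (y : ℂ) * Complex.I)) /
            Complex.Gamma ((c : ℂ) + μ + (-(t₀ : ℂ) + (y : ℂ) * Complex.I)))) := by
    intro y
    rw [IH y]
    have hG1 : Complex.Gamma (-(-(t₀ : ℂ) + (y : ℂ) * Complex.I)) ≠ 0 := Complex.Gamma_ne_zero_of_re_pos (by simp [ht₀])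
    have hG2 : Complex.Gamma (b 0 + (-(t₀ : ℂ) + (y : ℂ) * Complex.I)) ≠ 0 :=
      Complex.Gamma_ne_zero_of_re_pos (by simp; linarith)
    field_simp
  rw [integral_congr_ae (Eventually.of_forall hpt), integral_const_mul,
    integral_tsum_inner_eq (α := a₀) (β := a 0) ht₀ ht₀' hta hc hc1 hcab hε hθ0 hq D hD]
  have hπ : (π : ℂ) ≠ 0 := by exact_mod_cast Real.pi_pos.ne'
  set S : ℂ := ∑' μ : ℕ, D μ * ((-1 : ℂ) ^ μ * (Complex.Gamma (a₀ + μ) * Complex.Gamma (a 0 + μ) * Complex.Gamma (c - a₀ - a 0) /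
    (Complex.Gamma (c - a 0 + μ) * Complex.Gamma (c - a₀ + μ)))) with hS
  have h2π : (1 / (2 * π) : ℂ) * (2 * π) = 1 := by field_simp
  calc Complex.Gamma (b 0 - a 0) / Complex.Gamma a₀ * ((1 / (2 * π) : ℂ) * (R * (2 * π * S)))
      = Complex.Gamma (b 0 - a 0) / Complex.Gamma a₀ * R * ((1 / (2 * π) : ℂ) * (2 * π)) * S := by ring
    _ = _ := by rw [h2π]; ring

end Summit.KontsevichZagierPeriods.Zeta5Search.VWPStepCore

end
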